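/-
Copyright (c) 2026 the pub-hodgecm-mathlib formalisation cell (harness21).  Prover seat hodgecm-mathlib-LD1-p01 (g5), ROAD O («orthogonal copy»)
of line LD toward the printed socket `stub_letter_B6`, 2026-09-02.  THEOREMS ONLY (no definition, no named fact, no `sorry`, no instance, no notation).
`--supports stmt-HodgeConjecture-24832 --as helper`.
-/
import Summits.HodgeConjecture.HodgeConjecture.Theorems.F0LD1CharThetaSpaceLeOfIrreducible
import Literature.NumberTheory.Automorphic.UnitaryGroupCohomologicalForms
import Literature.NumberTheory.Automorphic.Liu2021.ThetaLiftFromLineIrreducible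
import HarnessLib

-- As in the lineage: statements over the theta-kernel datum elaborate to very large types; elaborate sequentially.
set_option Elab.async false

/-!
# Crux `HLiu418`, line LD, ROAD O («orthogonal copy») — THE GLUE: «`pr_P` of a theta class from `⟨a⟩` is non-zero» ⟹ «`P` MEETS the theta lift
# from `⟨a⟩`» WITHOUT multiplicity one, from NON-ORTHOGONALITY FOR EVERY discrete `P′` with the finite component `σ` and a UNITARY-CLASS PIN of theta spans

Cell hodgecm-mathlib (D-0151), FLOOR 0; crux item `HLiu418` = stmt-HodgeConjecture-24832; LD leaves `Cruxes/HLiu418/Lines/F0_P6LD_StubS1FactsThetaRoad.lean`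
(ED. 10, socket `stub_letter_B6 : ThetaSpaceRealises₂` :716) and `…StubS1bFactsOrganRoad.lean`.  Seat LD1-p01 (g5); memo
`F0/P6/LD/LD1-p01/g5/ROAD-O-orthogonal-copy.v1.LD1-p01g5.md`.  THEOREMS ONLY; `--supports stmt-HodgeConjecture-24832 --as helper`.  Rank-generic `N`.

THE STEP.  ★ `F0LD2MeetsOfNonOrthogonal.meetsThetaLiftFromLine_of_starProjection_ne_zero` (LD2-p02 (g0)) derives «`P` meets the theta lift from `⟨a⟩`»
from `pr_P [Θ̃_Φ(f) ∘ ιA] ≠ 0` using MULTIPLICITY ONE of `L²([U(H)])` (`hM1`).  Here `hM1` is REPLACED by two inputs that the in-house road can pay: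
* `hAP` — NON-ORTHOGONALITY FOR EVERY DISCRETE `P′` WITH THE FINITE COMPONENT `σ`: some theta class from SOME line `⟨b⟩` has `pr_{P′} ≠ 0` (the body of the
  printed letter (A₂-P) [Liu2021, Thm. B.4 (1) (a)⇒(c), stated for an ARBITRARY cuspidal realisation `V_π`, App. B p. 98] read WITHOUT the idle Hodge-type
  binder — LD-ref1 LETTER AUDIT 2026-09-02T12:30:11Z (n1));
* `hPin` — the UNITARY-CLASS PIN: two non-zero closed theta spans `Q̄(a, ξ′)`, `Q̄(b, ξ″)` both unitarily equivalent to `P` COINCIDE ([Liu2021, Thm. B.4 (2)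
  «`W` unique up to isomorphism» + Howe duality; in house: same-label classes, archimedean signs, Hasse, transport, organ (I), central characters);
together with `hσ : P.HasFinComponent σ` and `hIrr` (every closed theta span is `0` or irreducible — (I′), ★ in-house for the CM curves).
ARGUMENT ([Liu2021, proof of Cor. B.6 (3), p. 99 L64–67] with the second realisation chosen ORTHOGONAL to the theta span): character detection (★ K1) and
the theta span `Q = Q̄(a, ξ)` (★ `exists_closedSubrep_thetaSpan`), irreducible, `Q ≃ᵤ P` by the isometric part of `pr_P|_Q` (★
`ClosedSubrep.exists_le_orthogonal_areUnitarilyEquivalent`); if `Q ≠ P` then `P ⊄ Q`, and the same ★ lemma gives an irreducible `Q′ ≤ Qᗮ` with `P ≃ᵤ Q′`;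
`HasFinComponent σ` TRANSFERS to `Q′` along the equivalence (§1: it is an abstract-algebraic statement about the `U(H)(𝔸_f)`-action); `hAP` at `Q′` + ★ K1
give a line `b`, a character `ξ″` and the span `Q″ = Q̄(b, ξ″)` with `pr_{Q′} ≠ 0` on a generator, so `Q″ ≃ᵤ Q′ ≃ᵤ P`; `hPin` ⇒ `Q″ = Q ⊥ Q′` — contradiction.
So `Q = P`: the non-zero `(a, ξ)`-class lies IN `P`.

* §1 `hasFinComponent_of_equiv` — `P.HasFinComponent σ` passes along an equivalence `P.space ≃ P′.space` of continuous representations.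
* §2 **`meetsThetaLiftFromLine_of_starProjection_ne_zero_of_orthogonalCopy`** — the glue (binders of ★ (A₂-J) with `hM1 ↦ hσ, hIrr (all lines), hAP, hPin`).

HONEST LABEL: HC_CM is proved only modulo the 7 printed citations (2 remaining: hLiu418 = stmt-HodgeConjecture-24832, h413 = stmt-HodgeConjecture-24833)
until rung 0 closes; this file discharges none of them (it is glue toward retiring `stub_letter_B6` in favour of the Hodge-free reading of `stub_letter_A₂P`;
its inputs `hAP`, `hIrr`, `hPin` are paid elsewhere or printed).

## References
* [Liu2021] Y. Liu, Camb. J. Math. 9 (2021) = arXiv:2102.11518: App. B Thm. B.4 (1)(2) (p. 98), Cor. B.6 (1)(3) and proof (p. 99 L43–67); App. D proof of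
  Prop. D.4 (1) (p. 131 L8–27).
* [DeitmarEchterhoff2014] A. Deitmar, S. Echterhoff, 2nd ed., Cor. 6.1.9 (Schur for intertwiners of irreducible unitary representations).
* [Dixmier1977] J. Dixmier, *C\*-algebras*, §5.4.
* [BorelJacquet1979] A. Borel, H. Jacquet, PSPM 33.1 (1979), §4.6.
-/

set_option autoImplicit false
-- the mandated namespace has the single-problem summit's repeated segment (`HodgeConjecture.HodgeConjecture`)
set_option linter.dupNamespace false

noncomputable section

open NumberField MeasureTheory IsDedekindDomain
open scoped Matrix ComplexOrder ENNReal InnerProductSpace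

namespace Summit.HodgeConjecture.HodgeConjecture.Cruxes.HLiu418.F0LD1MeetsOfOrthogonalCopy

open _root_.MeasureTheory
open Literature.NumberTheory.Automorphic Literature.NumberTheory.Automorphic.UnitaryGroup
open Literature.NumberTheory.Automorphic.UnitaryGroup.CotangentForms
open Literature.NumberTheory.Automorphic.IdeleClassGroup
open Literature.NumberTheory.Automorphic.Liu2021
open Literature.NumberTheory.Automorphic.Liu2021.Def411WeilCarriers
open Literature.NumberTheory.Automorphic.Liu2021.Def411WeilCarriersDoubling
open Literature.NumberTheory.GelbartRogawski1991 Literature.NumberTheory.GelbartRogawski1991.UnitaryDualPair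
open Literature.NumberTheory.Weil1964
open Literature.RepresentationTheory.Liu2021
open Literature.RepresentationTheory.CompactGroups
open Summit.HodgeConjecture.HodgeConjecture.Cruxes.HLiu418.F0LD1ThetaTransportKit
open Summit.HodgeConjecture.HodgeConjecture.Cruxes.HLiu418.F0LD2FrameTransportPin
open Summit.HodgeConjecture.HodgeConjecture.Cruxes.HLiu418.F0LD1CharThetaSpaceLeOfIrreducible

/-! ## §1 `HasFinComponent` transfers along an equivalence of the underlying continuous representations -/

section Transfer

variable {F E : Type} [Field F] [NumberField F] [Field E] [NumberField E] [Algebra F E]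
  {c : E ≃ₐ[F] E} {N : ℕ} {J : Matrix (Fin N) (Fin N) E}
  {μ : Measure (adelicGroupData F E c N J).automorphicQuotient}
  [SMulInvariantMeasure (adelicGroupData F E c N J).Adelic (adelicGroupData F E c N J).automorphicQuotient μ]

/-- **`HasFinComponent σ` is transported by an equivalence of continuous representations** `e : P.space ≃ P′.space` (no isometry needed): compose the
injective `U(J)(𝔸_{F,f})`-intertwiner `σ → P.finRep` with `e`, which intertwines the restricted actions `P.finRep`, `P′.finRep` (restrictions of the
right-regular actions along ★ `finAdelicToAdelic`). [cite: BorelJacquet1979, §4.6] -/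
theorem hasFinComponent_of_equiv (P P' : DiscreteAutomorphicRep (adelicGroupData F E c N J) μ)
    (e : P.space.toContRep.Equiv P'.space.toContRep)
    {W : Type} [AddCommGroup W] [Module ℂ W] {σ : Representation ℂ (finAdelic F E c N J) W}
    (h : P.HasFinComponent σ) : P'.HasFinComponent σ := by
  obtain ⟨f, hf⟩ := h
  refine ⟨LinearMap.intertwiningMap_of_isIntertwiningMap (ρ := σ) (σ := P'.finRep)
      (f := e.toContIntertwiningMap.toIntertwiningMap.toLinearMap ∘ₗ f.toLinearMap) (fun k v => ?_),
    fun x y hxy => hf (EquivLike.injective e ?_)⟩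
  · show e.toContIntertwiningMap (f (σ k v)) = P'.finRep k (e.toContIntertwiningMap (f v))
    rw [Representation.IntertwiningMap.isIntertwining σ P.finRep f k v]
    exact e.toContIntertwiningMap.isIntertwining (finAdelicToAdelic F E c N J k) (f v)
  · exact hxy

end Transfer

/-! ## §2 The glue -/

variable (L : Type) [Field L] [NumberField L] [IsCMField L] (N : ℕ) (H : Matrix (Fin N) (Fin N) L)
  {n' : ℕ} (e₁ : Fin N × Fin 1 ≃ Fin n') (dV : Fin N → L) (hdV : ∀ i, IsCMField.complexConj L (dV i) = dV i)
  (hdV0 : ∀ i, dV i ≠ 0) (t : L) (ht : t ≠ 0) (g : GL (Fin N) L)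
  (hg : formCongr ((IsCMField.complexConj L : L ≃ₐ[(↥(maximalRealSubfield L))] L) : L →+* L) g (t • H) = Matrix.diagonal dV)
  (ιA : (adelicGroupData (↥(maximalRealSubfield L)) L (IsCMField.complexConj L) N H).Adelic →*
    ↥(UnitaryGroup.adelic (↥(maximalRealSubfield L)) L (IsCMField.complexConj L) N (Matrix.diagonal dV)))
  (hιA : ∀ k, ((ιA k : ↥(UnitaryGroup.adelic (↥(maximalRealSubfield L)) L (IsCMField.complexConj L) N (Matrix.diagonal dV))) :
      GL (Fin N) (AdeleRing (𝓞 L) L)) =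
    (toAdeleGL L g)⁻¹ * adelicVal (↥(maximalRealSubfield L)) L (IsCMField.complexConj L) N H k * toAdeleGL L g)
  [CompactSpace (↥(UnitaryGroup.adelic (↥(maximalRealSubfield L)) L (IsCMField.complexConj L) N (Matrix.diagonal dV)) ⧸
    (UnitaryGroup.toAdelic (↥(maximalRealSubfield L)) L (IsCMField.complexConj L) N (Matrix.diagonal dV)).range)]
  {μA : Measure (adelicGroupData (↥(maximalRealSubfield L)) L (IsCMField.complexConj L) N H).automorphicQuotient}
  [(adelicGroupData (↥(maximalRealSubfield L)) L (IsCMField.complexConj L) N H).IsAutomorphicMeasure μA]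
  [CompactSpace (adelicGroupData (↥(maximalRealSubfield L)) L (IsCMField.complexConj L) N H).automorphicQuotient]

include ht hg hιA

set_option maxHeartbeats 2400000 in
-- (statement size: four organ-sized hypotheses; every step is a named ★ lemma)
/-- **ROAD O GLUE: NON-ORTHOGONALITY ⟹ MEETS, WITHOUT MULTIPLICITY ONE.**  In the scaled rational frame `formCongr c g (t • H) = diag dV` with the pinned
transport `ιA` (`↑(ιA k) = g_𝔸⁻¹ k g_𝔸`), let `P` be a discrete automorphic representation of `U(H)` with `P.HasFinComponent σ` and `⟨a⟩` a hermitian line with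
the `μ`-splitting.  Assume: `hIrr` — for every line `⟨b⟩` and character `ξ` of `[U(⟨b⟩)]` the closed `(b, ξ)`-theta span is `0` or topologically irreducible
((I′), [Liu2021, Cor. B.6 (1)] = [Wu2013, Thm. 5.3], ★ in-house for the CM curves); `hAP` — for EVERY discrete `P′` with `P′.HasFinComponent σ` (and, fork-neutrally, `P ≃ᵤ P′` — chair (g1)) the projection
to `P′` of some theta class from some line `⟨b⟩` is non-zero ([Liu2021, Thm. B.4 (1) (a)⇒(c)] for an arbitrary cuspidal realisation, Hodge-free reading of
letter (A₂-P)); `hPin` — two non-zero closed theta spans `Q̄(a, ξ′)`, `Q̄(b, ξ″)` both unitarily equivalent to `P` are EQUAL ([Liu2021, Thm. B.4 (2)] + Howe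
duality, unitary-class currency); `hpr` — the projection to `P` of SOME theta class `[Θ̃_Φ(f) ∘ ιA]` from `⟨a⟩` is non-zero.  THEN `P` MEETS the theta lift from
`⟨a⟩` along `ιA` (★ `MeetsThetaLiftFromLine`).  Orthogonal-copy argument of the module docstring.
[cite: Liu2021, App. B Thm. B.4 (1)(2) (p. 98); Cor. B.6 (3) and its proof (p. 99 L64–67); App. D proof of Prop. D.4 (1) (p. 131)]
[cite: DeitmarEchterhoff2014, Cor. 6.1.9] [cite: Dixmier1977, §5.4] -/
theorem meetsThetaLiftFromLine_of_starProjection_ne_zero_of_orthogonalCopy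
    (P : DiscreteAutomorphicRep (adelicGroupData (↥(maximalRealSubfield L)) L (IsCMField.complexConj L) N H) μA)
    (μ : Literature.NumberTheory.Automorphic.IdeleClassGroup L →ₜ* Circle) (hμ : IsConjugateSymplectic L μ) (a : (↥(maximalRealSubfield L))ˣ)
    {W : Type} [AddCommGroup W] [Module ℂ W]
    (σ : Representation ℂ (finAdelic (↥(maximalRealSubfield L)) L (IsCMField.complexConj L) N H) W) (hσ : P.HasFinComponent σ)
    (hIrr : ∀ (b : (↥(maximalRealSubfield L))ˣ)
      (ξ : haveI := normal_range_toAdelic_JW L b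
        PontryaginDual (↥(UnitaryGroup.adelic (↥(maximalRealSubfield L)) L (IsCMField.complexConj L) 1 (JW (↥(maximalRealSubfield L)) L b)) ⧸ (UnitaryGroup.toAdelic (↥(maximalRealSubfield L)) L (IsCMField.complexConj L) 1 (JW (↥(maximalRealSubfield L)) L b)).range)),
      ThetaLiftFromLineIrreducible L N H e₁ dV hdV hdV0 ιA μA μ hμ b ξ)
    (hAP : ∀ P' : DiscreteAutomorphicRep (adelicGroupData (↥(maximalRealSubfield L)) L (IsCMField.complexConj L) N H) μA, P'.HasFinComponent σ →
      ContRepresentation.AreUnitarilyEquivalent P.space.toContRep P'.space.toContRep →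
      ∃ b : (↥(maximalRealSubfield L))ˣ,
      letI : MeasurableSpace (↥(UnitaryGroup.adelic (↥(maximalRealSubfield L)) L (IsCMField.complexConj L) 1 (JW (↥(maximalRealSubfield L)) L b)) ⧸ (UnitaryGroup.toAdelic (↥(maximalRealSubfield L)) L (IsCMField.complexConj L) 1 (JW (↥(maximalRealSubfield L)) L b)).range) := borel _
      haveI := normal_range_toAdelic_JW L b
      ∃ (hρ : HasThetaMajorants fun
          (p : ↥(UnitaryGroup.adelic (↥(maximalRealSubfield L)) L (IsCMField.complexConj L) N (Matrix.diagonal dV)) × ↥(UnitaryGroup.adelic (↥(maximalRealSubfield L)) L (IsCMField.complexConj L) 1 (JW (↥(maximalRealSubfield L)) L b))) (Φ : piSchwartzBruhat (↥(maximalRealSubfield L)) (Fin n')) =>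
            pairRep (↥(maximalRealSubfield L)) L (IsCMField.complexConj L) N 1 e₁ (Matrix.diagonal dV) (JW (↥(maximalRealSubfield L)) L b)
              (chiSplittingLine L e₁ dV hdV hdV0 (toHeckeCharacter L μ) (isUnitary_toHeckeCharacter L μ)
                ((isOscillatorChar_toHeckeCharacter_iff μ).mpr hμ) (TW (↥(maximalRealSubfield L)) b)
                (isUnit_det_TW (↥(maximalRealSubfield L)) b) (JW (↥(maximalRealSubfield L)) L b) (JW_eq (↥(maximalRealSubfield L)) L b))
              p Φ)
        (μW : Measure (↥(UnitaryGroup.adelic (↥(maximalRealSubfield L)) L (IsCMField.complexConj L) 1 (JW (↥(maximalRealSubfield L)) L b)) ⧸ (UnitaryGroup.toAdelic (↥(maximalRealSubfield L)) L (IsCMField.complexConj L) 1 (JW (↥(maximalRealSubfield L)) L b)).range))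
        (_ : IsFiniteMeasure μW)
        (_ : SMulInvariantMeasure ↥(UnitaryGroup.adelic (↥(maximalRealSubfield L)) L (IsCMField.complexConj L) 1 (JW (↥(maximalRealSubfield L)) L b)) (↥(UnitaryGroup.adelic (↥(maximalRealSubfield L)) L (IsCMField.complexConj L) 1 (JW (↥(maximalRealSubfield L)) L b)) ⧸ (UnitaryGroup.toAdelic (↥(maximalRealSubfield L)) L (IsCMField.complexConj L) 1 (JW (↥(maximalRealSubfield L)) L b)).range) μW)
        (f : C((↥(UnitaryGroup.adelic (↥(maximalRealSubfield L)) L (IsCMField.complexConj L) 1 (JW (↥(maximalRealSubfield L)) L b)) ⧸ (UnitaryGroup.toAdelic (↥(maximalRealSubfield L)) L (IsCMField.complexConj L) 1 (JW (↥(maximalRealSubfield L)) L b)).range), ℂ))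
        (Φ : piSchwartzBruhat (↥(maximalRealSubfield L)) (Fin n'))
        (hθ : MemLp (toQuotFun (adelicGroupData (↥(maximalRealSubfield L)) L (IsCMField.complexConj L) N H) fun x =>
          (lineThetaKernelDatum L N e₁ dV hdV hdV0 μ hμ b hρ).thetaLiftFun μW Φ f (ιA x)) 2 μA),
        P'.space.toSubmodule.starProjection (MemLp.toLp _ hθ) ≠ 0)
    (hPin : ∀ (b : (↥(maximalRealSubfield L))ˣ),
      letI : MeasurableSpace (↥(UnitaryGroup.adelic (↥(maximalRealSubfield L)) L (IsCMField.complexConj L) 1 (JW (↥(maximalRealSubfield L)) L a)) ⧸ (UnitaryGroup.toAdelic (↥(maximalRealSubfield L)) L (IsCMField.complexConj L) 1 (JW (↥(maximalRealSubfield L)) L a)).range) := borel _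
      haveI := normal_range_toAdelic_JW L a
      letI : MeasurableSpace (↥(UnitaryGroup.adelic (↥(maximalRealSubfield L)) L (IsCMField.complexConj L) 1 (JW (↥(maximalRealSubfield L)) L b)) ⧸ (UnitaryGroup.toAdelic (↥(maximalRealSubfield L)) L (IsCMField.complexConj L) 1 (JW (↥(maximalRealSubfield L)) L b)).range) := borel _
      haveI := normal_range_toAdelic_JW L b
      ∀ (ξ' : PontryaginDual (↥(UnitaryGroup.adelic (↥(maximalRealSubfield L)) L (IsCMField.complexConj L) 1 (JW (↥(maximalRealSubfield L)) L a)) ⧸ (UnitaryGroup.toAdelic (↥(maximalRealSubfield L)) L (IsCMField.complexConj L) 1 (JW (↥(maximalRealSubfield L)) L a)).range))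
        (ξ'' : PontryaginDual (↥(UnitaryGroup.adelic (↥(maximalRealSubfield L)) L (IsCMField.complexConj L) 1 (JW (↥(maximalRealSubfield L)) L b)) ⧸ (UnitaryGroup.toAdelic (↥(maximalRealSubfield L)) L (IsCMField.complexConj L) 1 (JW (↥(maximalRealSubfield L)) L b)).range))
        (Q' Q'' : ContRepresentation.ClosedSubrep ((adelicGroupData (↥(maximalRealSubfield L)) L (IsCMField.complexConj L) N H).rightRegular μA)),
        (Q'.toSubmodule : Set ((adelicGroupData (↥(maximalRealSubfield L)) L (IsCMField.complexConj L) N H).L2 μA)) = closure (Submodule.span ℂ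
            {v : (adelicGroupData (↥(maximalRealSubfield L)) L (IsCMField.complexConj L) N H).L2 μA | ∃ (hρ : HasThetaMajorants fun
          (p : ↥(UnitaryGroup.adelic (↥(maximalRealSubfield L)) L (IsCMField.complexConj L) N (Matrix.diagonal dV)) × ↥(UnitaryGroup.adelic (↥(maximalRealSubfield L)) L (IsCMField.complexConj L) 1 (JW (↥(maximalRealSubfield L)) L a))) (Φ : piSchwartzBruhat (↥(maximalRealSubfield L)) (Fin n')) =>
            pairRep (↥(maximalRealSubfield L)) L (IsCMField.complexConj L) N 1 e₁ (Matrix.diagonal dV) (JW (↥(maximalRealSubfield L)) L a)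
              (chiSplittingLine L e₁ dV hdV hdV0 (toHeckeCharacter L μ) (isUnitary_toHeckeCharacter L μ)
                ((isOscillatorChar_toHeckeCharacter_iff μ).mpr hμ) (TW (↥(maximalRealSubfield L)) a)
                (isUnit_det_TW (↥(maximalRealSubfield L)) a) (JW (↥(maximalRealSubfield L)) L a) (JW_eq (↥(maximalRealSubfield L)) L a))
              p Φ)
            (μW : Measure (↥(UnitaryGroup.adelic (↥(maximalRealSubfield L)) L (IsCMField.complexConj L) 1 (JW (↥(maximalRealSubfield L)) L a)) ⧸ (UnitaryGroup.toAdelic (↥(maximalRealSubfield L)) L (IsCMField.complexConj L) 1 (JW (↥(maximalRealSubfield L)) L a)).range)) (_ : IsFiniteMeasure μW)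
            (_ : SMulInvariantMeasure ↥(UnitaryGroup.adelic (↥(maximalRealSubfield L)) L (IsCMField.complexConj L) 1 (JW (↥(maximalRealSubfield L)) L a)) (↥(UnitaryGroup.adelic (↥(maximalRealSubfield L)) L (IsCMField.complexConj L) 1 (JW (↥(maximalRealSubfield L)) L a)) ⧸ (UnitaryGroup.toAdelic (↥(maximalRealSubfield L)) L (IsCMField.complexConj L) 1 (JW (↥(maximalRealSubfield L)) L a)).range) μW)
            (Ψ : piSchwartzBruhat (↥(maximalRealSubfield L)) (Fin n'))
            (hθ : MemLp (toQuotFun (adelicGroupData (↥(maximalRealSubfield L)) L (IsCMField.complexConj L) N H) fun x =>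
              (lineThetaKernelDatum L N e₁ dV hdV hdV0 μ hμ a hρ).thetaLiftFun μW Ψ (charCM ξ') (ιA x)) 2 μA),
            v = MemLp.toLp _ hθ} : Set ((adelicGroupData (↥(maximalRealSubfield L)) L (IsCMField.complexConj L) N H).L2 μA)) →
        (Q''.toSubmodule : Set ((adelicGroupData (↥(maximalRealSubfield L)) L (IsCMField.complexConj L) N H).L2 μA)) = closure (Submodule.span ℂ
            {v : (adelicGroupData (↥(maximalRealSubfield L)) L (IsCMField.complexConj L) N H).L2 μA | ∃ (hρ : HasThetaMajorants fun
          (p : ↥(UnitaryGroup.adelic (↥(maximalRealSubfield L)) L (IsCMField.complexConj L) N (Matrix.diagonal dV)) × ↥(UnitaryGroup.adelic (↥(maximalRealSubfield L)) L (IsCMField.complexConj L) 1 (JW (↥(maximalRealSubfield L)) L b))) (Φ : piSchwartzBruhat (↥(maximalRealSubfield L)) (Fin n')) =>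
            pairRep (↥(maximalRealSubfield L)) L (IsCMField.complexConj L) N 1 e₁ (Matrix.diagonal dV) (JW (↥(maximalRealSubfield L)) L b)
              (chiSplittingLine L e₁ dV hdV hdV0 (toHeckeCharacter L μ) (isUnitary_toHeckeCharacter L μ)
                ((isOscillatorChar_toHeckeCharacter_iff μ).mpr hμ) (TW (↥(maximalRealSubfield L)) b)
                (isUnit_det_TW (↥(maximalRealSubfield L)) b) (JW (↥(maximalRealSubfield L)) L b) (JW_eq (↥(maximalRealSubfield L)) L b))
              p Φ)
            (μW : Measure (↥(UnitaryGroup.adelic (↥(maximalRealSubfield L)) L (IsCMField.complexConj L) 1 (JW (↥(maximalRealSubfield L)) L b)) ⧸ (UnitaryGroup.toAdelic (↥(maximalRealSubfield L)) L (IsCMField.complexConj L) 1 (JW (↥(maximalRealSubfield L)) L b)).range)) (_ : IsFiniteMeasure μW)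
            (_ : SMulInvariantMeasure ↥(UnitaryGroup.adelic (↥(maximalRealSubfield L)) L (IsCMField.complexConj L) 1 (JW (↥(maximalRealSubfield L)) L b)) (↥(UnitaryGroup.adelic (↥(maximalRealSubfield L)) L (IsCMField.complexConj L) 1 (JW (↥(maximalRealSubfield L)) L b)) ⧸ (UnitaryGroup.toAdelic (↥(maximalRealSubfield L)) L (IsCMField.complexConj L) 1 (JW (↥(maximalRealSubfield L)) L b)).range) μW)
            (Ψ : piSchwartzBruhat (↥(maximalRealSubfield L)) (Fin n'))
            (hθ : MemLp (toQuotFun (adelicGroupData (↥(maximalRealSubfield L)) L (IsCMField.complexConj L) N H) fun x =>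
              (lineThetaKernelDatum L N e₁ dV hdV hdV0 μ hμ b hρ).thetaLiftFun μW Ψ (charCM ξ'') (ιA x)) 2 μA),
            v = MemLp.toLp _ hθ} : Set ((adelicGroupData (↥(maximalRealSubfield L)) L (IsCMField.complexConj L) N H).L2 μA)) →
        Q'.toSubmodule ≠ ⊥ →
        ContRepresentation.AreUnitarilyEquivalent P.space.toContRep Q'.toContRep →
        ContRepresentation.AreUnitarilyEquivalent P.space.toContRep Q''.toContRep → Q' = Q'')
    (hpr :
      letI : MeasurableSpace (↥(UnitaryGroup.adelic (↥(maximalRealSubfield L)) L (IsCMField.complexConj L) 1 (JW (↥(maximalRealSubfield L)) L a)) ⧸ (UnitaryGroup.toAdelic (↥(maximalRealSubfield L)) L (IsCMField.complexConj L) 1 (JW (↥(maximalRealSubfield L)) L a)).range) := borel _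
      haveI := normal_range_toAdelic_JW L a
      ∃ (hρ : HasThetaMajorants fun
          (p : ↥(UnitaryGroup.adelic (↥(maximalRealSubfield L)) L (IsCMField.complexConj L) N (Matrix.diagonal dV)) × ↥(UnitaryGroup.adelic (↥(maximalRealSubfield L)) L (IsCMField.complexConj L) 1 (JW (↥(maximalRealSubfield L)) L a))) (Φ : piSchwartzBruhat (↥(maximalRealSubfield L)) (Fin n')) =>
            pairRep (↥(maximalRealSubfield L)) L (IsCMField.complexConj L) N 1 e₁ (Matrix.diagonal dV) (JW (↥(maximalRealSubfield L)) L a)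
              (chiSplittingLine L e₁ dV hdV hdV0 (toHeckeCharacter L μ) (isUnitary_toHeckeCharacter L μ)
                ((isOscillatorChar_toHeckeCharacter_iff μ).mpr hμ) (TW (↥(maximalRealSubfield L)) a)
                (isUnit_det_TW (↥(maximalRealSubfield L)) a) (JW (↥(maximalRealSubfield L)) L a) (JW_eq (↥(maximalRealSubfield L)) L a))
              p Φ)
        (μW : Measure (↥(UnitaryGroup.adelic (↥(maximalRealSubfield L)) L (IsCMField.complexConj L) 1 (JW (↥(maximalRealSubfield L)) L a)) ⧸ (UnitaryGroup.toAdelic (↥(maximalRealSubfield L)) L (IsCMField.complexConj L) 1 (JW (↥(maximalRealSubfield L)) L a)).range))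
        (_ : IsFiniteMeasure μW)
        (_ : SMulInvariantMeasure ↥(UnitaryGroup.adelic (↥(maximalRealSubfield L)) L (IsCMField.complexConj L) 1 (JW (↥(maximalRealSubfield L)) L a)) (↥(UnitaryGroup.adelic (↥(maximalRealSubfield L)) L (IsCMField.complexConj L) 1 (JW (↥(maximalRealSubfield L)) L a)) ⧸ (UnitaryGroup.toAdelic (↥(maximalRealSubfield L)) L (IsCMField.complexConj L) 1 (JW (↥(maximalRealSubfield L)) L a)).range) μW)
        (f : C((↥(UnitaryGroup.adelic (↥(maximalRealSubfield L)) L (IsCMField.complexConj L) 1 (JW (↥(maximalRealSubfield L)) L a)) ⧸ (UnitaryGroup.toAdelic (↥(maximalRealSubfield L)) L (IsCMField.complexConj L) 1 (JW (↥(maximalRealSubfield L)) L a)).range), ℂ))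
        (Φ : piSchwartzBruhat (↥(maximalRealSubfield L)) (Fin n'))
        (hθ : MemLp (toQuotFun (adelicGroupData (↥(maximalRealSubfield L)) L (IsCMField.complexConj L) N H) fun x =>
          (lineThetaKernelDatum L N e₁ dV hdV hdV0 μ hμ a hρ).thetaLiftFun μW Φ f (ιA x)) 2 μA),
        P.space.toSubmodule.starProjection (MemLp.toLp _ hθ) ≠ 0) :
    MeetsThetaLiftFromLine L N H e₁ dV hdV hdV0 P μ hμ a ιA := by
  letI : MeasurableSpace (↥(UnitaryGroup.adelic (↥(maximalRealSubfield L)) L (IsCMField.complexConj L) 1 (JW (↥(maximalRealSubfield L)) L a)) ⧸ (UnitaryGroup.toAdelic (↥(maximalRealSubfield L)) L (IsCMField.complexConj L) 1 (JW (↥(maximalRealSubfield L)) L a)).range) := borel _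
  haveI : BorelSpace (↥(UnitaryGroup.adelic (↥(maximalRealSubfield L)) L (IsCMField.complexConj L) 1 (JW (↥(maximalRealSubfield L)) L a)) ⧸ (UnitaryGroup.toAdelic (↥(maximalRealSubfield L)) L (IsCMField.complexConj L) 1 (JW (↥(maximalRealSubfield L)) L a)).range) := ⟨rfl⟩
  haveI := normal_range_toAdelic_JW L a
  -- the pinned transport is continuous and carries rational points to rational points
  have hιA' : Continuous ιA ∧ ∀ ⦃γ : (adelicGroupData (↥(maximalRealSubfield L)) L (IsCMField.complexConj L) N H).Adelic⦄,
      γ ∈ (UnitaryGroup.toAdelic (↥(maximalRealSubfield L)) L (IsCMField.complexConj L) N H).range →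
        ιA γ ∈ (UnitaryGroup.toAdelic (↥(maximalRealSubfield L)) L (IsCMField.complexConj L) N (Matrix.diagonal dV)).range :=
    ⟨continuous_of_pin L N H dV g ιA hιA, fun _ hγ => mem_range_toAdelic_of_pin L N H dV t ht g hg ιA hιA hγ⟩
  have hR := (adelicGroupData (↥(maximalRealSubfield L)) L (IsCMField.complexConj L) N H).isUnitary_rightRegular μA
  obtain ⟨hρ, μW, hfinW, hinvW, f, Φ, hθ, hne⟩ := hpr
  haveI : IsFiniteMeasure μW := hfinW
  haveI : SMulInvariantMeasure ↥(UnitaryGroup.adelic (↥(maximalRealSubfield L)) L (IsCMField.complexConj L) 1 (JW (↥(maximalRealSubfield L)) L a))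
      (↥(UnitaryGroup.adelic (↥(maximalRealSubfield L)) L (IsCMField.complexConj L) 1 (JW (↥(maximalRealSubfield L)) L a)) ⧸ (UnitaryGroup.toAdelic (↥(maximalRealSubfield L)) L (IsCMField.complexConj L) 1 (JW (↥(maximalRealSubfield L)) L a)).range) μW := hinvW
  -- STEP 1: character detection through `pr_P` (the `MemLp` witness is proof-irrelevant: read it as the uniform one)
  have hne' : P.space.toSubmodule.starProjection
      (MemLp.toLp _ (memLp_toQuotFun_lineThetaLift L N H e₁ dV hdV hdV0 ιA hιA' μ hμ a hρ μW Φ f μA 2)) ≠ 0 := hne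
  obtain ⟨ξ, hξ⟩ := exists_charCM_of_apply_toLp_lineThetaLift_ne_zero L N H e₁ dV hdV hdV0 ιA hιA' μ hμ a hρ μW Φ f μA
    P.space.toSubmodule.starProjection hne'
  set v := MemLp.toLp _ (memLp_toQuotFun_lineThetaLift L N H e₁ dV hdV hdV0 ιA hιA' μ hμ a hρ μW Φ (charCM ξ) μA 2) with hvdef
  have hv : P.space.toSubmodule.starProjection v ≠ 0 := hξ
  have hv0 : v ≠ 0 := fun h0 => hv (by rw [h0, map_zero])
  -- STEP 2: the `(a, ξ)`-theta span `Q`, a closed invariant subspace containing `v`, irreducible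
  obtain ⟨Q, hQmem, hQcar⟩ := exists_closedSubrep_thetaSpan L N H e₁ dV hdV hdV0 t ht g hg ιA hιA (μA := μA) μ hμ a ξ
  have hvQ : v ∈ Q.toSubmodule := hQmem hρ μW hfinW hinvW Φ _
  have hQne : Q.toSubmodule ≠ ⊥ := fun hbot => hv0 ((Submodule.mem_bot ℂ).1 (hbot ▸ hvQ))
  have hQirr : Q.toContRep.IsTopIrreducible := by
    rcases hIrr a ξ Q hQcar with hbot | hirr
    · exact absurd hbot hQne
    · exact hirr
  -- STEP 3: the compression of `pr_P` to `Q` — `Q` is unitarily equivalent to `P`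
  have hnot : ¬ Q ≤ P.space.orthogonal hR := by
    intro hle
    apply hv
    have hvorth : v ∈ P.space.toSubmoduleᗮ := hle hvQ
    exact (Submodule.starProjection_apply_eq_zero_iff _).2 hvorth
  obtain ⟨W'', hW''le, e, he⟩ :=
    ContRepresentation.ClosedSubrep.exists_le_orthogonal_areUnitarilyEquivalent hR (P.space.orthogonal hR) Q hQirr hnot
  rw [ContRepresentation.ClosedSubrep.orthogonal_orthogonal] at hW''le
  have hW''irr : W''.toContRep.IsTopIrreducible := (ContRepresentation.isTopIrreducible_congr e).1 hQirr
  have hW''nt : Nontrivial W''.toSubmodule := by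
    refine ⟨⟨e ⟨v, hvQ⟩, 0, fun h0 => hv0 ?_⟩⟩
    have h1 : (⟨v, hvQ⟩ : Q.toSubmodule) = 0 := EquivLike.injective e (by rw [h0, map_zero] : e ⟨v, hvQ⟩ = e 0)
    exact congrArg Subtype.val h1
  have hW''eq : W'' = P.space := ContRepresentation.ClosedSubrep.eq_of_le_of_isTopIrreducible P.irreducible hW''nt hW''le
  subst hW''eq
  have hPQ : ContRepresentation.AreUnitarilyEquivalent P.space.toContRep Q.toContRep :=
    ContRepresentation.AreUnitarilyEquivalent.symm ⟨e, he⟩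
  -- STEP 4: `Q = P` by the ORTHOGONAL COPY (no multiplicity one)
  suffices hQP : Q = P.space by exact ⟨hρ, μW, hfinW, hinvW, charCM ξ, Φ, _, hQP ▸ hvQ, hv0⟩
  by_contra hQP
  -- `P ⊄ Q` (else `P = Q` by irreducibility of `Q`)
  have hnle : ¬ P.space ≤ Q := fun hle =>
    hQP (ContRepresentation.ClosedSubrep.eq_of_le_of_isTopIrreducible hQirr P.nontrivial_space hle).symm
  -- the orthogonal copy `Q' ≤ Qᗮ`, `P ≃ᵤ Q'`
  obtain ⟨Q', hQ'le, e', he'⟩ :=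
    ContRepresentation.ClosedSubrep.exists_le_orthogonal_areUnitarilyEquivalent hR Q P.space P.irreducible hnle
  have hQ'irr : Q'.toContRep.IsTopIrreducible := (ContRepresentation.isTopIrreducible_congr e').1 P.irreducible
  let P' : DiscreteAutomorphicRep (adelicGroupData (↥(maximalRealSubfield L)) L (IsCMField.complexConj L) N H) μA := ⟨Q', hQ'irr⟩
  -- `HasFinComponent σ` transfers to the copy (§1)
  have hσ' : P'.HasFinComponent σ := hasFinComponent_of_equiv P P' e' hσ
  -- non-orthogonality at the copy: a line `b`, then a character `ξb` (★ K1), then the span `Qb = Q̄(b, ξb)`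
  obtain ⟨b, hb⟩ := hAP P' hσ' ⟨e', he'⟩
  letI : MeasurableSpace (↥(UnitaryGroup.adelic (↥(maximalRealSubfield L)) L (IsCMField.complexConj L) 1 (JW (↥(maximalRealSubfield L)) L b)) ⧸ (UnitaryGroup.toAdelic (↥(maximalRealSubfield L)) L (IsCMField.complexConj L) 1 (JW (↥(maximalRealSubfield L)) L b)).range) := borel _
  haveI : BorelSpace (↥(UnitaryGroup.adelic (↥(maximalRealSubfield L)) L (IsCMField.complexConj L) 1 (JW (↥(maximalRealSubfield L)) L b)) ⧸ (UnitaryGroup.toAdelic (↥(maximalRealSubfield L)) L (IsCMField.complexConj L) 1 (JW (↥(maximalRealSubfield L)) L b)).range) := ⟨rfl⟩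
  haveI := normal_range_toAdelic_JW L b
  obtain ⟨hρb, μWb, hfinb, hinvb, fb, Φb, hθb, hneb⟩ := hb
  haveI : IsFiniteMeasure μWb := hfinb
  haveI : SMulInvariantMeasure ↥(UnitaryGroup.adelic (↥(maximalRealSubfield L)) L (IsCMField.complexConj L) 1 (JW (↥(maximalRealSubfield L)) L b))
      (↥(UnitaryGroup.adelic (↥(maximalRealSubfield L)) L (IsCMField.complexConj L) 1 (JW (↥(maximalRealSubfield L)) L b)) ⧸ (UnitaryGroup.toAdelic (↥(maximalRealSubfield L)) L (IsCMField.complexConj L) 1 (JW (↥(maximalRealSubfield L)) L b)).range) μWb := hinvb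
  have hneb' : P'.space.toSubmodule.starProjection
      (MemLp.toLp _ (memLp_toQuotFun_lineThetaLift L N H e₁ dV hdV hdV0 ιA hιA' μ hμ b hρb μWb Φb fb μA 2)) ≠ 0 := hneb
  obtain ⟨ξb, hξb⟩ := exists_charCM_of_apply_toLp_lineThetaLift_ne_zero L N H e₁ dV hdV hdV0 ιA hιA' μ hμ b hρb μWb Φb fb μA
    P'.space.toSubmodule.starProjection hneb'
  set vb := MemLp.toLp _ (memLp_toQuotFun_lineThetaLift L N H e₁ dV hdV hdV0 ιA hιA' μ hμ b hρb μWb Φb (charCM ξb) μA 2) with hvbdef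
  have hvb : Q'.toSubmodule.starProjection vb ≠ 0 := hξb
  have hvb0 : vb ≠ 0 := fun h0 => hvb (by rw [h0, map_zero])
  obtain ⟨Qb, hQbmem, hQbcar⟩ := exists_closedSubrep_thetaSpan L N H e₁ dV hdV hdV0 t ht g hg ιA hιA (μA := μA) μ hμ b ξb
  have hvbQ : vb ∈ Qb.toSubmodule := hQbmem hρb μWb hfinb hinvb Φb _
  have hQbne : Qb.toSubmodule ≠ ⊥ := fun hbot => hvb0 ((Submodule.mem_bot ℂ).1 (hbot ▸ hvbQ))
  have hQbirr : Qb.toContRep.IsTopIrreducible := by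
    rcases hIrr b ξb Qb hQbcar with hbot | hirr
    · exact absurd hbot hQbne
    · exact hirr
  -- `Qb ≃ᵤ Q'` by the isometric part of `pr_{Q'}|_{Qb}`
  have hnotb : ¬ Qb ≤ Q'.orthogonal hR := by
    intro hle
    apply hvb
    have hvorth : vb ∈ Q'.toSubmoduleᗮ := hle hvbQ
    exact (Submodule.starProjection_apply_eq_zero_iff _).2 hvorth
  obtain ⟨W₃, hW₃le, e₃, he₃⟩ :=
    ContRepresentation.ClosedSubrep.exists_le_orthogonal_areUnitarilyEquivalent hR (Q'.orthogonal hR) Qb hQbirr hnotb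
  rw [ContRepresentation.ClosedSubrep.orthogonal_orthogonal] at hW₃le
  have hW₃irr : W₃.toContRep.IsTopIrreducible := (ContRepresentation.isTopIrreducible_congr e₃).1 hQbirr
  have hW₃nt : Nontrivial W₃.toSubmodule := by
    refine ⟨⟨e₃ ⟨vb, hvbQ⟩, 0, fun h0 => hvb0 ?_⟩⟩
    have h1 : (⟨vb, hvbQ⟩ : Qb.toSubmodule) = 0 := EquivLike.injective e₃ (by rw [h0, map_zero] : e₃ ⟨vb, hvbQ⟩ = e₃ 0)
    exact congrArg Subtype.val h1
  have hW₃eq : W₃ = Q' := ContRepresentation.ClosedSubrep.eq_of_le_of_isTopIrreducible hQ'irr hW₃nt hW₃le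
  subst hW₃eq
  have hPQb : ContRepresentation.AreUnitarilyEquivalent P.space.toContRep Qb.toContRep :=
    ContRepresentation.AreUnitarilyEquivalent.trans ⟨e', he'⟩ (ContRepresentation.AreUnitarilyEquivalent.symm ⟨e₃, he₃⟩)
  -- THE PIN: `Q = Qb`; but `vb ∈ Qb = Q` is orthogonal to the copy `Q' ≤ Qᗮ` while `pr_{Q'} vb ≠ 0`
  have hQQb : Q = Qb := hPin b ξ ξb Q Qb hQcar hQbcar hQne hPQ hPQb
  apply hvb
  have hvbQ' : vb ∈ W₃.toSubmoduleᗮ := by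
    rw [Submodule.mem_orthogonal]
    intro u hu
    exact Submodule.inner_left_of_mem_orthogonal (K := Q.toSubmodule) (hQQb ▸ hvbQ) (hQ'le hu)
  exact (Submodule.starProjection_apply_eq_zero_iff _).2 hvbQ'

end Summit.HodgeConjecture.HodgeConjecture.Cruxes.HLiu418.F0LD1MeetsOfOrthogonalCopy

end
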